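import Mathlib
import Literature.RepresentationTheory.FiniteGroups.IrreducibleCharacters
import Summits.MatrixMultiplication.MatrixMultiplication.Theorems.LevelGradedCohnUmansGradedDesignFamilyStubWreathBudgetIndex

/-!
# Stub `stub_tilingUniversality` for the line `tiling-families` of `LevelGradedCohnUmans.GradedDesignFamily`

Regime II of the family criterion ("asymptotically perfect graded STPP tilings by many small
blocks").  A TILING FAMILY is a fixed block-to-dimension ratio `λ > 1` together with, for every
efficiency `η < 1`, a finite host `G`, a bi-invariant test space `J ≤ ℂ^G` with wall
`D = Σ_{χ ∈ Irr G ∩ J} χ(1)² > 0`, and `t` simultaneously `J`-separated blocks `(X_i, Y_i, Z_i)`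
with `(λ χ(1))³ ≤ V_i = |X_i||Y_i||Z_i|` for every block `i` and every visible irreducible `χ`, and
`η D ≤ Σ_i V_i^{2/3}`.  Such a family yields, for every `ε > 0`, a graded simultaneous family at
exponent `2 + ε`: `Σ_{χ ∈ Irr G ∩ J} χ(1)^{2+ε} < Σ_i V_i^{(2+ε)/3}` — the hypothesis of the landed
wreath link `gradedWreathLink_proof`.

The proof is power-mean bookkeeping, reduced to landed lemmas of this crux
(`wreathBudget_one_le_re`: visible degrees are `≥ 1`) plus a real-analytic core
(`tilingUniversality_abstract`): with `d = max_{Irr∩J} χ(1) ≥ 1`, the budget is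
`Σ χ(1)² χ(1)^ε ≤ d^ε D`, while `V_i ≥ (λ d)³` gives `V_i^{(2+ε)/3} ≥ V_i^{2/3} (λ d)^ε`, so the
value is `≥ (λ d)^ε η D`; choosing `η = λ^{-ε/2}` makes `η λ^ε = λ^{ε/2} > 1`, and `d^ε D > 0` gives
strictness.  [cite: CohnKleinbergSzegedyUmans2005, Thm. 5.5 and Thm. 7.1]
-/

noncomputable section

set_option linter.dupNamespace false

open scoped BigOperators
open Literature.RepresentationTheory.FiniteGroups

namespace Summit.MatrixMultiplication.MatrixMultiplication.Theorems.GradedDesignFamily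

/-- Choice of the efficiency: for `λ > 1` and `ε > 0` the value `η = λ^{-ε/2}` satisfies
`0 < η < 1` and `η λ^ε = λ^{ε/2} > 1`. -/
theorem tilingUniversality_eta {lam ε : ℝ} (hlam : 1 < lam) (hε : 0 < ε) :
    ∃ η : ℝ, η < 1 ∧ 0 < η ∧ 1 < η * lam ^ ε := by
  have hlam0 : 0 < lam := one_pos.trans hlam
  refine ⟨lam ^ (-(ε / 2)), ?_, Real.rpow_pos_of_pos hlam0 _, ?_⟩
  · exact Real.rpow_lt_one_of_one_lt_of_neg hlam (by linarith)
  · rw [← Real.rpow_add hlam0, show -(ε / 2) + ε = ε / 2 by ring]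
    exact Real.one_lt_rpow hlam (by linarith)

/-- Termwise value bound: if `0 < m`, `m³ ≤ V` and `0 ≤ e` then `V^{2/3} m^e ≤ V^{(2+e)/3}`
(since `m^e = (m³)^{e/3} ≤ V^{e/3}` and `V^{(2+e)/3} = V^{2/3} V^{e/3}`). -/
theorem tilingUniversality_term_value {m V e : ℝ} (hm : 0 < m) (hV : m ^ (3 : ℕ) ≤ V)
    (he : 0 ≤ e) : V ^ ((2 : ℝ) / 3) * m ^ e ≤ V ^ ((2 + e) / 3) := by
  have hV0 : 0 < V := (pow_pos hm 3).trans_le hV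
  have h1 : V ^ ((2 + e) / 3) = V ^ ((2 : ℝ) / 3) * V ^ (e / 3) := by
    rw [← Real.rpow_add hV0]
    congr 1
    ring
  rw [h1]
  refine mul_le_mul_of_nonneg_left ?_ (Real.rpow_nonneg hV0.le _)
  calc m ^ e = (m ^ (3 : ℕ)) ^ (e / 3) := by
        rw [← Real.rpow_natCast_mul hm.le]
        congr 1
        push_cast
        ring
    _ ≤ V ^ (e / 3) := Real.rpow_le_rpow (pow_nonneg hm.le 3) hV (by linarith)

/-- Termwise budget bound: if `0 < d ≤ m` and `0 ≤ e` then `d^{2+e} ≤ d² m^e`. -/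
theorem tilingUniversality_term_budget {d m e : ℝ} (hd : 0 < d) (hdm : d ≤ m) (he : 0 ≤ e) :
    d ^ (2 + e) ≤ d ^ (2 : ℝ) * m ^ e := by
  rw [Real.rpow_add hd]
  exact mul_le_mul_of_nonneg_left (Real.rpow_le_rpow hd.le hdm he) (Real.rpow_nonneg hd.le _)

/-- **The real-analytic core of `stub_tilingUniversality`.**  A finite index set `S` with
"degrees" `d χ ≥ 1` and wall `D = Σ_{χ ∈ S} (d χ)² > 0`, "volumes" `V i ≥ (λ d χ)³` for every `i`
and every `χ ∈ S` (`λ > 0`), an efficiency `η` with `η D ≤ Σ_i (V i)^{2/3}` and `η λ^ε > 1`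
(`ε > 0`) force `Σ_{χ ∈ S} (d χ)^{2+ε} < Σ_i (V i)^{(2+ε)/3}`. -/
theorem tilingUniversality_abstract {α : Type*} (S : Finset α) (d : α → ℝ) (t : ℕ)
    (V : Fin t → ℝ) (lam η ε : ℝ) (hlam : 0 < lam) (hε : 0 < ε) (hkey : 1 < η * lam ^ ε)
    (hd : ∀ χ ∈ S, 1 ≤ d χ) (hD : 0 < ∑ χ ∈ S, d χ ^ (2 : ℝ))
    (hvol : ∀ i : Fin t, ∀ χ ∈ S, (lam * d χ) ^ (3 : ℕ) ≤ V i)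
    (heta : η * ∑ χ ∈ S, d χ ^ (2 : ℝ) ≤ ∑ i, V i ^ ((2 : ℝ) / 3)) :
    ∑ χ ∈ S, d χ ^ (2 + ε) < ∑ i, V i ^ ((2 + ε) / 3) := by
  -- the wall is positive, so `S` is nonempty: pick a character of maximal degree
  have hSne : S.Nonempty := by
    rw [Finset.nonempty_iff_ne_empty]
    rintro rfl
    rw [Finset.sum_empty] at hD
    exact lt_irrefl _ hD
  obtain ⟨χ₀, hχ₀, hmax⟩ := S.exists_max_image d hSne
  have hm0 : 0 < d χ₀ := one_pos.trans_le (hd χ₀ hχ₀)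
  have hlm : 0 < lam * d χ₀ := mul_pos hlam hm0
  -- (1) the graded budget is at most `D · d_max^ε`
  have hbud : ∑ χ ∈ S, d χ ^ (2 + ε) ≤ (∑ χ ∈ S, d χ ^ (2 : ℝ)) * d χ₀ ^ ε := by
    rw [Finset.sum_mul]
    exact Finset.sum_le_sum fun χ hχ =>
      tilingUniversality_term_budget (one_pos.trans_le (hd χ hχ)) (hmax χ hχ) hε.le
  -- (2) the value is at least `(Σ_i V_i^{2/3}) · (λ d_max)^ε`
  have hval : (∑ i, V i ^ ((2 : ℝ) / 3)) * (lam * d χ₀) ^ ε ≤ ∑ i, V i ^ ((2 + ε) / 3) := by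
    rw [Finset.sum_mul]
    exact Finset.sum_le_sum fun i _ => tilingUniversality_term_value hlm (hvol i χ₀ hχ₀) hε.le
  -- (3) comparison: `D d^ε < (η λ^ε) D d^ε = (η D) (λ d)^ε ≤ (Σ V^{2/3}) (λ d)^ε`
  have hpos : 0 < (∑ χ ∈ S, d χ ^ (2 : ℝ)) * d χ₀ ^ ε := mul_pos hD (Real.rpow_pos_of_pos hm0 _)
  calc ∑ χ ∈ S, d χ ^ (2 + ε) ≤ (∑ χ ∈ S, d χ ^ (2 : ℝ)) * d χ₀ ^ ε := hbud
    _ = 1 * ((∑ χ ∈ S, d χ ^ (2 : ℝ)) * d χ₀ ^ ε) := (one_mul _).symm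
    _ < (η * lam ^ ε) * ((∑ χ ∈ S, d χ ^ (2 : ℝ)) * d χ₀ ^ ε) :=
        mul_lt_mul_of_pos_right hkey hpos
    _ = (η * ∑ χ ∈ S, d χ ^ (2 : ℝ)) * (lam * d χ₀) ^ ε := by
        rw [Real.mul_rpow hlam.le hm0.le]
        ring
    _ ≤ (∑ i, V i ^ ((2 : ℝ) / 3)) * (lam * d χ₀) ^ ε :=
        mul_le_mul_of_nonneg_right heta (Real.rpow_nonneg hlm.le _)
    _ ≤ ∑ i, V i ^ ((2 + ε) / 3) := hval

/-- **stub_tilingUniversality — tiling families give graded simultaneous families at every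
exponent `2 + ε`.**  A fixed block-to-dimension ratio `λ > 1` and, for every efficiency `η < 1`,
a finite host with a bi-invariant `J`, positive wall `D = Σ_{Irr∩J} χ(1)²`, `t` simultaneously
`J`-separated blocks of volumes `V_i ≥ (λ χ(1))³` for all visible `χ`, and `η D ≤ Σ_i V_i^{2/3}`,
yield for every `ε > 0` a simultaneously `J`-separated family with
`Σ_{χ ∈ Irr G ∩ J} χ(1)^{2+ε} < Σ_i V_i^{(2+ε)/3}` (take `η = λ^{-ε/2}`; power means, host-free).
[cite: CohnKleinbergSzegedyUmans2005, Thm. 5.5 and Thm. 7.1] -/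
theorem stub_tilingUniversality
    (h : ∃ lam : ℝ, 1 < lam ∧ ∀ η : ℝ, η < 1 → ∃ (G : Type) (_ : Group G) (_ : Fintype G)
      (J : Submodule ℂ (G → ℂ)) (t : ℕ) (X Y Z : Fin t → Finset G),
      (∀ f ∈ J, ∀ a b : G, (fun g : G => f (a * g * b)) ∈ J) ∧
      (∀ i : Fin t, ∀ x₀ ∈ X i, ∀ z₀ ∈ Z i, ∃ f ∈ J, ∀ a b : Fin t, ∀ x ∈ X a, ∀ y ∈ Y a,
        ∀ y' ∈ Y b, ∀ z ∈ Z b,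
          ((a = i ∧ b = i ∧ x = x₀ ∧ y = y' ∧ z = z₀) → f (x⁻¹ * y * y'⁻¹ * z) = 1) ∧
          (¬ (a = i ∧ b = i ∧ x = x₀ ∧ y = y' ∧ z = z₀) → f (x⁻¹ * y * y'⁻¹ * z) = 0)) ∧
      (0 < ∑ᶠ χ ∈ Literature.RepresentationTheory.FiniteGroups.irrChars G ∩ (J : Set (G → ℂ)),
        (χ 1).re ^ (2 : ℝ)) ∧
      (∀ i : Fin t, ∀ χ ∈ Literature.RepresentationTheory.FiniteGroups.irrChars G ∩
        (J : Set (G → ℂ)),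
          (lam * (χ 1).re) ^ (3 : ℕ) ≤ (((X i).card * (Y i).card * (Z i).card : ℕ) : ℝ)) ∧
      (η * ∑ᶠ χ ∈ Literature.RepresentationTheory.FiniteGroups.irrChars G ∩ (J : Set (G → ℂ)),
        (χ 1).re ^ (2 : ℝ) ≤
          ∑ i, (((X i).card * (Y i).card * (Z i).card : ℕ) : ℝ) ^ ((2 : ℝ) / 3)))
    (ε : ℝ) (hε : 0 < ε) :
    ∃ (G : Type) (_ : Group G) (_ : Fintype G) (J : Submodule ℂ (G → ℂ)) (t : ℕ)
      (X Y Z : Fin t → Finset G),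
      (∀ f ∈ J, ∀ a b : G, (fun g : G => f (a * g * b)) ∈ J) ∧
      (∀ i : Fin t, ∀ x₀ ∈ X i, ∀ z₀ ∈ Z i, ∃ f ∈ J, ∀ a b : Fin t, ∀ x ∈ X a, ∀ y ∈ Y a,
        ∀ y' ∈ Y b, ∀ z ∈ Z b,
          ((a = i ∧ b = i ∧ x = x₀ ∧ y = y' ∧ z = z₀) → f (x⁻¹ * y * y'⁻¹ * z) = 1) ∧
          (¬ (a = i ∧ b = i ∧ x = x₀ ∧ y = y' ∧ z = z₀) → f (x⁻¹ * y * y'⁻¹ * z) = 0)) ∧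
      (∑ᶠ χ ∈ Literature.RepresentationTheory.FiniteGroups.irrChars G ∩ (J : Set (G → ℂ)),
        (χ 1).re ^ (2 + ε)) <
        ∑ i, (((X i).card * (Y i).card * (Z i).card : ℕ) : ℝ) ^ ((2 + ε) / 3) := by
  obtain ⟨lam, hlam, hfam⟩ := h
  obtain ⟨η, hη1, -, hkey⟩ := tilingUniversality_eta hlam hε
  obtain ⟨G, _instG, _instF, J, t, X, Y, Z, hJ, hsep, hD, hvol, heta⟩ := hfam η hη1
  refine ⟨G, inferInstance, inferInstance, J, t, X, Y, Z, hJ, hsep, ?_⟩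
  have hfin : (irrChars G ∩ (J : Set (G → ℂ))).Finite :=
    (irrChars_finite_holds G).subset Set.inter_subset_left
  rw [finsum_mem_eq_finite_toFinset_sum _ hfin] at hD heta
  rw [finsum_mem_eq_finite_toFinset_sum _ hfin]
  exact tilingUniversality_abstract hfin.toFinset (fun χ => (χ 1).re) t
    (fun i => (((X i).card * (Y i).card * (Z i).card : ℕ) : ℝ)) lam η ε (one_pos.trans hlam) hε
    hkey (fun χ hχ => wreathBudget_one_le_re (hfin.mem_toFinset.mp hχ).1) hD
    (fun i χ hχ => hvol i χ (hfin.mem_toFinset.mp hχ)) heta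

end Summit.MatrixMultiplication.MatrixMultiplication.Theorems.GradedDesignFamily

end
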